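import Literature.NumberTheory.Transcendental.RoySmallValueAlgebraicPoints
import Mathlib.FieldTheory.Normal.Basic
import Mathlib.FieldTheory.IsAlgClosed.Basic
import Mathlib.NumberTheory.NumberField.InfinitePlace.Embeddings
import Mathlib.FieldTheory.Galois.Basic
import HarnessLib

/-!
# Roy's small value estimate for `𝔾ₐ × 𝔾ₘ` — orbits of `𝒵(P, Q)` with the number field as a parameter

Topic `Literature/NumberTheory/Transcendental`. Part of the formalisation of the proof of Roy 2013,
Theorem 1.1 (named fact `roy2013_thm_1_1`, `RoySmallValueEstimates.lean`). Source: D. Roy,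
*A small value estimate for `𝔾ₐ × 𝔾ₘ`*, Mathematika 59 (2013) 333–363 = arXiv:1301.0663, §6–§7:

> Step 3. Denote by `D*` the smallest positive integer for which
> `Z ⊆ 𝒵(𝒟ⁱP̃_{D*+1} ; 0 ≤ i < 2⌊(D*+1)^τ⌋)` [...]

In Step 3 of the proof of Theorem 1.1 the SAME zero-dimensional `ℚ`-subvariety `Z` (an orbit of
conjugate points) is viewed inside the zero sets of two different pairs of forms (in degrees `D`
and `D* + 1`). To compare the two situations, this file re-runs the bookkeeping of
`RoySmallValueOrbits` (where the number field is generated by the configuration itself) with the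
normal number field `K ⊂ ℂ` as a PARAMETER (`ZeroConfigK K ι`: the representatives are only
required to have coordinates in `K`), and provides a normal number field containing any given
finite set of algebraic numbers (`closureField`), so that one field serves all the configurations
met along the proof. The statements and proofs are those of `RoySmallValueOrbits`, verbatim up to
this change. Everything is proved; no named facts.

## References

* [Roy2013] D. Roy, *A small value estimate for 𝔾ₐ × 𝔾ₘ*, Mathematika 59 (2013), 333–363
  (arXiv:1301.0663), §2, §6 (proof of Prop. 6.4) and §7, Step 3.
-/

noncomputable section

open MvPolynomial Finset Polynomial IntermediateField

namespace Literature.NumberTheory.Transcendental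

namespace Roy2013

/-! ### A normal number field containing finitely many algebraic numbers -/

/-- The subfield of `ℂ` generated over `ℚ` by all conjugates of the elements of `S`. [folklore] -/
def closureField (S : Finset ℂ) : IntermediateField ℚ ℂ :=
  IntermediateField.adjoin ℚ ((∏ x ∈ S, minpoly ℚ x).rootSet ℂ)

/-- It is a splitting field. [folklore] -/
instance isSplittingField_closureField (S : Finset ℂ) :
    (∏ x ∈ S, minpoly ℚ x).IsSplittingField ℚ (closureField S) :=
  IntermediateField.adjoin_rootSet_isSplittingField (IsAlgClosed.splits _)

/-- It is normal over `ℚ`. [folklore] -/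
instance normal_closureField (S : Finset ℂ) : Normal ℚ (closureField S) :=
  Normal.of_isSplittingField (∏ x ∈ S, minpoly ℚ x)

/-- It is finite over `ℚ`. [folklore] -/
instance finiteDimensional_closureField (S : Finset ℂ) : FiniteDimensional ℚ (closureField S) :=
  Polynomial.IsSplittingField.finiteDimensional (closureField S) (∏ x ∈ S, minpoly ℚ x)

/-- It is a number field. [folklore] -/
instance numberField_closureField (S : Finset ℂ) : NumberField (closureField S) := NumberField.mk

/-- It contains `S` (if `S` consists of algebraic numbers). [folklore] -/
theorem mem_closureField {S : Finset ℂ} (hS : ∀ x ∈ S, IsAlgebraic ℚ x) {x : ℂ} (hx : x ∈ S) :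
    x ∈ closureField S := by
  have hne : (∏ y ∈ S, minpoly ℚ y) ≠ 0 :=
    Finset.prod_ne_zero_iff.mpr fun y hy => minpoly.ne_zero (hS y hy).isIntegral
  refine IntermediateField.subset_adjoin ℚ _ ((Polynomial.mem_rootSet_of_ne hne).mpr ?_)
  rw [map_prod]
  exact Finset.prod_eq_zero hx (minpoly.aeval ℚ x)

/-! ### The configuration of zeros, with a given field -/

/-- **A normalised system of representatives of `𝒵(P, Q)` with coordinates in `K`** (as
`ZeroConfig`, with the number field `K` given in advance). [cite: Roy2013, §6, proof of
Proposition 6.4 ("a system of representatives `α₁, …, α_t` of the points of `𝒵(P,Q)(ℂ)`")] -/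
structure ZeroConfigK (K : IntermediateField ℚ ℂ) (ι : Type*) [Fintype ι] where
  /-- the representatives -/
  α : ι → Fin 3 → ℂ
  /-- the pivot (first non-zero coordinate) -/
  piv : ι → Fin 3
  /-- the two rational forms -/
  P : QX
  /-- the two rational forms -/
  Q : QX
  piv_one : ∀ i, α i (piv i) = 1
  piv_min : ∀ i k, α i k ≠ 0 → piv i ≤ k
  mem : ∀ i k, α i k ∈ K
  zero : ∀ i, eval (α i) (toCX P) = 0 ∧ eval (α i) (toCX Q) = 0
  cov : ∀ β : Fin 3 → ℂ, β ≠ 0 → eval β (toCX P) = 0 → eval β (toCX Q) = 0 →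
    ∃ i, ∃ t : ℂ, β = t • α i
  sep : ∀ i j, i ≠ j → ¬∃ t : ℂ, α j = t • α i

namespace ZeroConfigK

variable {K : IntermediateField ℚ ℂ} {ι : Type*} [Fintype ι] (Z : ZeroConfigK K ι)

/-- The representatives are non-zero. [folklore] -/
theorem α_ne_zero (i : ι) : Z.α i ≠ 0 := fun h => by
  have := Z.piv_one i; rw [h, Pi.zero_apply] at this; exact zero_ne_one this

/-- **The representatives with coordinates in `K`.** [cite: Roy2013, §6, proof of Prop. 6.4] -/
def rep (i : ι) : Fin 3 → K := fun k => ⟨Z.α i k, Z.mem i k⟩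

/-- Their complex coordinates. [folklore] -/
@[simp] theorem coe_rep (i : ι) (k : Fin 3) : ((Z.rep i k : K) : ℂ) = Z.α i k := rfl

/-- The representatives are non-zero in `K³`. [folklore] -/
theorem rep_ne_zero (i : ι) : Z.rep i ≠ 0 := fun h => by
  have h1 := congr_fun h (Z.piv i)
  have h2 : ((Z.rep i (Z.piv i) : K) : ℂ) = 0 := by rw [h1]; rfl
  rw [coe_rep, Z.piv_one] at h2
  exact one_ne_zero h2

/-- Values of rational polynomials at the `K`-representatives, seen in `ℂ`. [folklore] -/
theorem coe_aeval_rep (i : ι) (R : QX) :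
    ((MvPolynomial.aeval (Z.rep i) R : K) : ℂ) = eval (Z.α i) (toCX R) := by
  rw [eval_toCX]
  exact congrArg (fun φ : QX →ₐ[ℚ] ℂ => φ R) (MvPolynomial.comp_aeval (K.val) (f := Z.rep i))

/-- The `K`-representatives are common zeros of `P, Q`. [folklore] -/
theorem aeval_rep_P (i : ι) : MvPolynomial.aeval (Z.rep i) Z.P = 0 := by
  apply Subtype.ext
  rw [coe_aeval_rep, (Z.zero i).1]; rfl

/-- The `K`-representatives are common zeros of `P, Q`. [folklore] -/
theorem aeval_rep_Q (i : ι) : MvPolynomial.aeval (Z.rep i) Z.Q = 0 := by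
  apply Subtype.ext
  rw [coe_aeval_rep, (Z.zero i).2]; rfl

/-! ### Automorphisms permute the representatives -/

/-- The image of a representative under an automorphism, as a complex point. [folklore] -/
def img (g : K ≃ₐ[ℚ] K) (i : ι) : Fin 3 → ℂ := fun k => ((g (Z.rep i k) : K) : ℂ)

/-- Images are common zeros of `P, Q`. [folklore] -/
theorem eval_img (g : K ≃ₐ[ℚ] K) (i : ι) (R : QX)
    (hR : MvPolynomial.aeval (Z.rep i) R = 0) : eval (Z.img g i) (toCX R) = 0 := by
  have h1 : MvPolynomial.aeval (fun k => g (Z.rep i k)) R = 0 := by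
    have h := congrArg (fun φ : QX →ₐ[ℚ] K => φ R)
      (MvPolynomial.comp_aeval (g : K →ₐ[ℚ] K) (f := Z.rep i))
    simp only [AlgHom.coe_comp, Function.comp_apply, AlgEquiv.coe_toAlgHom] at h
    rw [← h, hR, map_zero]
  have h2 : ((MvPolynomial.aeval (fun k => g (Z.rep i k)) R : K) : ℂ) =
      eval (Z.img g i) (toCX R) := by
    rw [eval_toCX]
    exact congrArg (fun φ : QX →ₐ[ℚ] ℂ => φ R)
      (MvPolynomial.comp_aeval (K.val) (f := fun k => g (Z.rep i k)))
  rw [← h2, h1]; rfl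

/-- The zero pattern of the image is that of the representative. [folklore] -/
theorem img_eq_zero_iff (g : K ≃ₐ[ℚ] K) (i : ι) (k : Fin 3) :
    Z.img g i k = 0 ↔ Z.α i k = 0 := by
  rw [img]
  constructor
  · intro h
    have h1 : g (Z.rep i k) = 0 := Subtype.ext h
    have h2 : Z.rep i k = 0 := by simpa using h1
    have h3 := congrArg (fun x : K => (x : ℂ)) h2
    simpa using h3
  · intro h
    have h1 : Z.rep i k = 0 := Subtype.ext h
    rw [h1, map_zero]; rfl

/-- **Automorphisms permute the representatives exactly**: for `g ∈ Aut(K/ℚ)` and `i` there is a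
unique `j` with `g(a_i) = a_j` coordinatewise. [cite: Roy2013, §6 ("the points of `Z(ℂ)` are
conjugate over `ℚ`"); construction of this development] -/
theorem existsUnique_img_eq (g : K ≃ₐ[ℚ] K) (i : ι) : ∃! j, Z.img g i = Z.α j := by
  have himg0 : Z.img g i ≠ 0 := by
    intro h
    have := (Z.img_eq_zero_iff g i (Z.piv i)).mp (congr_fun h (Z.piv i))
    rw [Z.piv_one] at this
    exact one_ne_zero this
  obtain ⟨j, t, hjt⟩ := Z.cov (Z.img g i) himg0 (Z.eval_img g i Z.P (Z.aeval_rep_P i))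
    (Z.eval_img g i Z.Q (Z.aeval_rep_Q i))
  have ht : t ≠ 0 := fun h0 => himg0 (by rw [hjt, h0, zero_smul])
  -- pivots agree, hence `t = 1`
  have hpiv : Z.piv i = Z.piv j := by
    apply le_antisymm
    · apply Z.piv_min i
      intro h0
      have h1 := (Z.img_eq_zero_iff g i (Z.piv j)).mpr h0
      rw [hjt, Pi.smul_apply, smul_eq_mul, Z.piv_one, mul_one] at h1
      exact ht h1
    · apply Z.piv_min j
      intro h0
      have h1 : Z.img g i (Z.piv i) = 0 := by rw [hjt, Pi.smul_apply, smul_eq_mul, h0, mul_zero]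
      rw [Z.img_eq_zero_iff, Z.piv_one] at h1
      exact one_ne_zero h1
  have ht1 : t = 1 := by
    have h1 := congr_fun hjt (Z.piv i)
    rw [Pi.smul_apply, smul_eq_mul, hpiv, Z.piv_one, mul_one] at h1
    rw [← h1, img, ← hpiv]
    have : g (Z.rep i (Z.piv i)) = 1 := by
      have h2 : Z.rep i (Z.piv i) = 1 := Subtype.ext (Z.piv_one i)
      rw [h2, map_one]
    rw [this]; rfl
  refine ⟨j, by rw [hjt, ht1, one_smul], fun j' hj' => ?_⟩
  by_contra hne
  exact Z.sep j j' (fun h => hne h.symm) ⟨1, by rw [one_smul, ← hj', hjt, ht1, one_smul]⟩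

/-- **The permutation `perm g` of the indices** induced by `g ∈ Aut(K/ℚ)`.
[cite: Roy2013, §6 (conjugate points); construction of this development] -/
def perm (g : K ≃ₐ[ℚ] K) (i : ι) : ι := Classical.choose (Z.existsUnique_img_eq g i).exists

/-- `g(a_i) = a_{perm g i}` as complex points. [folklore] -/
theorem img_eq (g : K ≃ₐ[ℚ] K) (i : ι) : Z.img g i = Z.α (Z.perm g i) :=
  Classical.choose_spec (Z.existsUnique_img_eq g i).exists

/-- Characterisation of `perm`. [folklore] -/
theorem perm_eq_iff (g : K ≃ₐ[ℚ] K) (i j : ι) : Z.perm g i = j ↔ Z.img g i = Z.α j := by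
  constructor
  · rintro rfl; exact Z.img_eq g i
  · intro h; exact (Z.existsUnique_img_eq g i).unique (Z.img_eq g i) h

/-- `g ∘ a_i = a_{perm g i}` in `K³`. [folklore] -/
theorem rep_perm (g : K ≃ₐ[ℚ] K) (i : ι) : (fun k => g (Z.rep i k)) = Z.rep (Z.perm g i) := by
  funext k
  apply Subtype.ext
  exact congr_fun (Z.img_eq g i) k

/-- `perm 1 = id`. [folklore] -/
theorem perm_one (i : ι) : Z.perm 1 i = i := by
  rw [perm_eq_iff]; rfl

/-- `perm (g h) = perm g ∘ perm h`. [folklore] -/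
theorem perm_mul (g h : K ≃ₐ[ℚ] K) (i : ι) : Z.perm (g * h) i = Z.perm g (Z.perm h i) := by
  rw [perm_eq_iff]
  funext k
  change (((g * h) (Z.rep i k) : K) : ℂ) = Z.α (Z.perm g (Z.perm h i)) k
  rw [AlgEquiv.mul_apply, show h (Z.rep i k) = Z.rep (Z.perm h i) k from congr_fun (Z.rep_perm h i) k]
  exact congr_fun (Z.img_eq g (Z.perm h i)) k

/-- `perm g` is a bijection. [folklore] -/
theorem perm_bijective (g : K ≃ₐ[ℚ] K) : Function.Bijective (Z.perm g) := by
  have hinv : ∀ i, Z.perm g⁻¹ (Z.perm g i) = i := fun i => by rw [← perm_mul, inv_mul_cancel, perm_one]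
  have hinv' : ∀ i, Z.perm g (Z.perm g⁻¹ i) = i := fun i => by rw [← perm_mul, mul_inv_cancel, perm_one]
  exact ⟨fun i j hij => by rw [← hinv i, ← hinv j, hij], fun j => ⟨Z.perm g⁻¹ j, hinv' j⟩⟩

/-- `perm g` as an element of the symmetric group. [folklore] -/
def permEquiv (g : K ≃ₐ[ℚ] K) : Equiv.Perm ι := Equiv.ofBijective _ (Z.perm_bijective g)

/-- Coercion of `permEquiv`. [folklore] -/
@[simp] theorem permEquiv_apply (g : K ≃ₐ[ℚ] K) (i : ι) : Z.permEquiv g i = Z.perm g i := rfl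

/-! ### Embeddings and automorphisms -/

variable [Normal ℚ K]


/-- The automorphism of the normal field `K` induced by a complex embedding (restriction to a
normal subfield). [folklore] -/
def autOfEmb (σ : K →+* ℂ) : K ≃ₐ[ℚ] K := (σ.toRatAlgHom).restrictNormal' K

/-- `autOfEmb σ` followed by the inclusion is `σ`. [folklore] -/
theorem coe_autOfEmb (σ : K →+* ℂ) (x : K) : ((autOfEmb σ x : K) : ℂ) = σ x := by
  have h := AlgHom.restrictNormal_commutes (σ.toRatAlgHom) K x
  exact h

/-- The embedding induced by an automorphism. [folklore] -/
def embOfAut (g : K ≃ₐ[ℚ] K) : K →+* ℂ := (K.val : K →ₐ[ℚ] ℂ).toRingHom.comp g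

variable (K) in
/-- **Complex embeddings of `K` ↔ automorphisms of `K`.** [folklore] -/
def embEquivAut : (K →+* ℂ) ≃ (K ≃ₐ[ℚ] K) where
  toFun := autOfEmb
  invFun := embOfAut
  left_inv σ := by
    ext x
    change ((autOfEmb σ x : K) : ℂ) = σ x
    exact coe_autOfEmb σ x
  right_inv g := by
    ext x
    have h1 : ((autOfEmb (embOfAut g) x : K) : ℂ) = embOfAut g x := coe_autOfEmb _ x
    have h2 : (embOfAut g x) = ((g x : K) : ℂ) := rfl
    rw [h2] at h1
    exact Subtype.ext h1 |> fun h => by exact_mod_cast congrArg (fun y : K => y) h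

/-- The conjugate `σ(a_j)` is the complex point `α_{perm (autOfEmb σ) j}`. [folklore] -/
theorem emb_comp_rep (σ : K →+* ℂ) (j : ι) : (σ ∘ Z.rep j : Fin 3 → ℂ) = Z.α (Z.perm (autOfEmb σ) j) := by
  funext k
  rw [Function.comp_apply, ← coe_autOfEmb σ]
  exact congr_fun (Z.img_eq (autOfEmb σ) j) k

/-! ### Orbits -/

variable [NumberField K]


omit [Normal ℚ K] in
/-- **The orbit of `i₀`** (the "component `Z`" through `α_{i₀}`). [cite: Roy2013, §6, proof of
Proposition 6.4 ("an irreducible component `Z` of `W`")] -/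
def orb [DecidableEq ι] (i₀ : ι) : Finset ι :=
  univ.filter fun j => ∃ g : K ≃ₐ[ℚ] K, Z.perm g i₀ = j

omit [Normal ℚ K] in
/-- `i₀` is in its orbit. [folklore] -/
theorem self_mem_orb [DecidableEq ι] (i₀ : ι) : i₀ ∈ Z.orb i₀ :=
  mem_filter.mpr ⟨mem_univ _, 1, Z.perm_one i₀⟩

omit [Normal ℚ K] in
/-- Orbits are stable under the permutations. [folklore] -/
theorem perm_mem_orb [DecidableEq ι] {i₀ j : ι} (hj : j ∈ Z.orb i₀) (g : K ≃ₐ[ℚ] K) :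
    Z.perm g j ∈ Z.orb i₀ := by
  obtain ⟨-, h, rfl⟩ := mem_filter.mp hj
  exact mem_filter.mpr ⟨mem_univ _, g * h, Z.perm_mul g h i₀⟩

omit [Normal ℚ K] in
/-- **Orbit sums are invariant**: `∑_{j ∈ O} f(perm g j) = ∑_{j ∈ O} f(j)`. [folklore] -/
theorem sum_orb_perm [DecidableEq ι] {M : Type*} [AddCommMonoid M] (i₀ : ι) (g : K ≃ₐ[ℚ] K)
    (f : ι → M) : ∑ j ∈ Z.orb i₀, f (Z.perm g j) = ∑ j ∈ Z.orb i₀, f j := by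
  refine Finset.sum_bij (fun j _ => Z.perm g j) (fun j hj => Z.perm_mem_orb hj g)
    (fun j₁ _ j₂ _ h => (Z.perm_bijective g).1 h) (fun j hj => ?_) (fun _ _ => rfl)
  refine ⟨Z.perm g⁻¹ j, Z.perm_mem_orb hj g⁻¹, ?_⟩
  rw [← perm_mul, mul_inv_cancel, perm_one]

/-- **Sums over embeddings are sums over automorphisms.** [folklore] -/
theorem sum_emb_eq_sum_aut {M : Type*} [AddCommMonoid M] (H : (K ≃ₐ[ℚ] K) → M) :
    ∑ σ : K →+* ℂ, H (autOfEmb σ) = ∑ g : K ≃ₐ[ℚ] K, H g :=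
  Fintype.sum_equiv (embEquivAut K) _ _ fun _ => rfl

/-- **Sums over conjugates**: for a function `F` of the complex point,
`∑_{σ : K → ℂ} F(σ(a_j)) = ∑_{g ∈ Aut(K/ℚ)} F(α_{perm g j})`. [folklore] -/
theorem sum_emb_apply_rep {M : Type*} [AddCommMonoid M] (F : (Fin 3 → ℂ) → M) (j : ι) :
    ∑ σ : K →+* ℂ, F (σ ∘ Z.rep j) = ∑ g : K ≃ₐ[ℚ] K, F (Z.α (Z.perm g j)) := by
  rw [← sum_emb_eq_sum_aut (fun g => F (Z.α (Z.perm g j)))]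
  exact Finset.sum_congr rfl fun σ _ => by rw [Z.emb_comp_rep]

/-- **The key identity**: `∑_{j ∈ O} ∑_{σ : K → ℂ} F(σ(a_j)) = #Aut(K/ℚ) · ∑_{j ∈ O} F(α_j)` for an
orbit `O` and a function `F` of the complex point (per-point statements over `K`, summed over an
orbit, become statements about the orbit). [cite: Roy2013, §2 ("`h(Z) = ∑ m_i h(Z_i)`",
additivity on cycles); bookkeeping of this development] -/
theorem sum_orb_sum_emb [DecidableEq ι] {M : Type*} [AddCommMonoid M] (i₀ : ι)
    (F : (Fin 3 → ℂ) → M) :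
    ∑ j ∈ Z.orb i₀, ∑ σ : K →+* ℂ, F (σ ∘ Z.rep j) =
      Fintype.card (K ≃ₐ[ℚ] K) • ∑ j ∈ Z.orb i₀, F (Z.α j) := by
  simp_rw [Z.sum_emb_apply_rep]
  rw [Finset.sum_comm]
  simp_rw [Z.sum_orb_perm i₀ _ (fun j => F (Z.α j))]
  rw [Finset.sum_const, Finset.card_univ]

variable (K) in
omit [Fintype ι] in
/-- The number of automorphisms is the degree `[K : ℚ]` (`K` is Galois over `ℚ`). [folklore] -/
theorem card_aut_eq_finrank : Fintype.card (K ≃ₐ[ℚ] K) = Module.finrank ℚ K := by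
  rw [← Fintype.card_congr (embEquivAut K), NumberField.Embeddings.card]

end ZeroConfigK

end Roy2013

end Literature.NumberTheory.Transcendental
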